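import Summits.QuantumFields.YangMills.Theorems.BalabanUVNodesN15KingModelCarriers
import Summits.QuantumFields.YangMills.Theorems.BalabanUVNodesN15BumpLattice
import Summits.QuantumFields.YangMills.Theorems.BalabanUVNodesN15PartitionKingTorus
import HarnessLib

/-!
# BalabanUVNodes ∕ N15 — THE KING-MODEL RUNG, CURVED EDITION (PART Υ-a′): TOOLS FOR THE SECOND-ORDER `L²` MEMBERS OF [B9] (3.46) AT `U ≡ 1`, II —
# a `C^{1,1}` BLOCK CUT-OFF on King's fine torus (dag-n15-w4's sampled bump `bcube`, read at a unit block): plateau ⊇ the block and its forward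
# steps, support ⊂ the blocks at sup-distance `≤ 2`, `|∂χ| ≤ π∕N`, `|Δχ| ≤ 16π⁴(d+1)∕N²`
# (Track A, DAG node N15 = NE2; FAN-OUT v1.1 §N15 s3 «KING-MODEL RUNG … + the one-line statement of what the curved case adds»)

HONEST FRAMING.  Count-neutral lattice calculus (cell `pub-ymgap`, seat `pub-ymgap-dag-n15-e` g17; `--supports stmt-QuantumFields-27366 --as helper` =
K3⁸ `SpineGivenEndpointR13SepCoPHV`).  Nothing of [B9] ∕ [King1986] is asserted: this is the cut-off by which part Υ-b localises the torus `H²`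
identity of part Υ-a (`…FullPropagatorL2SecondOrderTools`) to decide the members `‖h∇∇Gλ‖`, `‖hG∇*∇*λ‖` of [Balaban1985BackgroundPropagators]
Thm 3.1 (3.46) p. 398 at `U ≡ 1` for King's full `A = 0` propagator.  A cut-off varying on the scale of ONE BLOCK (`N` fine steps) is
needed — an indicator's jump costs `N²` in `N²Δ(χu)`; [Balaban1984PropagatorsII] (2.36) p. 229 prints the shape `|∂h| ≤ O(1)M⁻¹`,
`|∂²h| ≤ O(1)M⁻²`.  The bump is dag-n15-w4's `N15.Gluing.bcube` (FILES I–II `…N15BumpProfile` ∕ `…N15BumpLattice`: plateau, support, the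
`π`-Lipschitz letter, FILE I's second-difference letter `abs_bumpPer_second_diff_le`) with dag-n15-w4 g0's coordinates `…N15PartitionKingTorus.kingTorus_hξ`,
all BY NAME; new here: the generic second-difference letter of the PRODUCT bump (§1) and the reading at King's unit blocks (§2: centring
`ξ_ν = x_ν.val∕N − (1 + 1∕N)∕2`, radius `R = 1`, so that every `N ≥ 3` is served and FILE I's condition `K ≥ 2R + 4` reads `M_ν ≥ 6`, i.e. cubes
`2L^e` with `e ≥ 1`).  NOT Bałaban's `G(U)`; NE2⁺ NOT PRINTED ∕ not proved; NOT a node discharge; nothing continuum ∕ ℝ⁴ ∕ OS ∕ mass-gap ∕ Clay.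
0 `sorry`, 0 `def` (the coordinates `ξ_ν(x) = x_ν.val∕N − (1 + 1∕N)∕2` and the cut-off `bcube Kc ξ 1 b` are written INLINE, as dag-n15-w4 does), standard axioms.
* §1 ★ `abs_sdiff_bcube_le` (`|χ̃_k(e_μx) − 2χ̃_k(x) + χ̃_k(e_μ⁻¹x)| ≤ 16π⁴s²`, generic: FILE 61's `hξ`, `K ≥ 2R + 4`, `R ≥ 0`, `0 ≤ s ≤ 1`);
* §2 (cut-off `χ_b := bcube Kc ξ 1 b`, inline) `blockBump_nonneg ∕ _le_one`; `bumpXi_hξ ∕ _hξ₂` (shift compatibility), `bumpXi_site_sub`, `abs_offset_add_le_one ∕ abs_offset_le`;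
  ★ `blockBump_eq_one_of_coords` ⇒ **`blockBump_eq_one_of_blockOf_eq ∕ blockBump_add_eq_one_of_blockOf_eq ∕ blockBump_add_add_eq_one_of_blockOf_eq`**
  (PLATEAU: `χ_b = 1` at `x`, `x + e_μ`, `x + e_μ + e_ν` for `B(x) = b`); ★ `tdistT_le_two_of_blockBump_ne_zero` ⇒ **`…_self ∕ tdistT_le_two_of_blockBump_add_ne_zero ∕
  …_sub_ne_zero`** (SUPPORT: `χ_b(y) ≠ 0` for `y ∈ {x, x ± e_μ}` ⟹ `|b − B(x)|_∞ ≤ 2`, `N ≥ 3`); **`abs_blockBump_add_sub_le ∕ abs_blockBump_sub_sub_le`** (`≤ π∕N`);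
  `abs_sdiff_blockBump_le` (`≤ 16π⁴∕N²`), ★★ **`abs_lapOp_blockBump_le`** (`|Δχ_b| ≤ 16π⁴(d+1)∕N²`; `M_ν = Kc ≥ 6`).
WHAT THE CURVED CASE ADDS (one line): nothing here — a background-free cut-off.
Locators: [Balaban1984PropagatorsII] (2.36) p. 229 (block cut-offs: shape); [Balaban1985BackgroundPropagators] Thm 3.1 (3.46) p. 398; [King1986] (4.36) p. 674 (blocks).
-/

noncomputable section

namespace Summit.QuantumFields.YangMills.BalabanUVNodes.N15KingModelRung.Curved

open Real Finset Matrix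
open Literature.MathematicalPhysics.QuantumFieldTheory.Balaban1983to89.B5Prop11Plancherel (Tor fine unitVec)
open Literature.MathematicalPhysics.QuantumFieldTheory.King1986.Torus (site blockEquiv blockEquiv_apply blockOf blockOf_site val_site blockProj
  tdistT tdistT_le_of_coord)
open Summit.QuantumFields.YangMills.BalabanUVNodes.N15.KingModel (fwdDiff adjDiff lapOp fwdDiff_apply lapOp_apply)
open Literature.MathematicalPhysics.QuantumFieldTheory.Balaban1983to89.B4TorusKernel.MultiPeriod (circAbs circAbs_add_mul circAbs_le_abs)
open Summit.QuantumFields.YangMills.BalabanUVNodes.N15.Gluing (bcube bcube_nonneg bcube_le_one bcube_eq_one_of_forall_abs_cenRep_le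
  abs_cenRep_lt_of_bcube_ne_zero bcube_shift bcube_shift_symm bprod_shift_eq bprod_shift_eq' bprod_erase_mem bcube_eq_mul bumpPer cenRep
  cenRep_add_int_mul abs_cenRep_le_abs_sub abs_bumpPer_second_diff_le abs_fgrad_bcube_le abs_bgrad_bcube_le kingTorus_hξ)

variable {d : ℕ}

/-! ## §1 The second difference of the sampled bump (generic) -/

section Bump

open Summit.QuantumFields.YangMills.BalabanUVNodes.N15.Gluing in
/-- ★ **THE SECOND-DIFFERENCE LETTER OF THE SAMPLED BUMP** (generic, dag-n15-w4's vocabulary): under FILE 61's shift compatibility `hξ`, for `K ≥ 2R + 4`,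
`R ≥ 0`, `0 ≤ s ≤ 1`: `|χ̃_k(e_μx) − 2χ̃_k(x) + χ̃_k(e_μ⁻¹x)| ≤ 16π⁴s²` — FILE I `abs_bumpPer_second_diff_le` on the factor `μ`, the other factors in `[0, 1]`.
[cite: Balaban1984PropagatorsII, (2.36) p.229 («|∂²h| ≤ O(1)M⁻²»: shape)] -/
theorem abs_sdiff_bcube_le {X J : Type} [Fintype J] [DecidableEq J] (K : ℕ) (ξ : J → X → ℝ) {R : ℝ} (e : J → X ≃ X) {s : ℝ} (hK : 0 < K)
    (hξ : ∀ μ ν x, ∃ z : ℤ, ξ ν (e μ x) = ξ ν x + (if ν = μ then s else 0) + z * K) (hR : 0 ≤ R) (hRK : 2 * R + 4 ≤ K) (hs : 0 ≤ s)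
    (hs1 : s ≤ 1) (k : J → ZMod K) (μ : J) (x : X) :
    |bcube K ξ R k (e μ x) - 2 * bcube K ξ R k x + bcube K ξ R k ((e μ).symm x)| ≤ 16 * π ^ 4 * s ^ 2 := by
  rw [bcube_shift K ξ R e hK hξ, bprod_shift_eq, bcube_shift_symm K ξ R e hK hξ, bprod_shift_eq', bcube_eq_mul K ξ R k μ x]
  set Pr := ∏ ν ∈ Finset.univ.erase μ, bumpPer K R (ξ ν x - ((k ν).val : ℝ))
  have hPr := bprod_erase_mem K ξ R k μ x
  rw [show bumpPer K R (ξ μ x + s - ((k μ).val : ℝ)) * Pr - 2 * (bumpPer K R (ξ μ x - ((k μ).val : ℝ)) * Pr)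
      + bumpPer K R (ξ μ x - s - ((k μ).val : ℝ)) * Pr
      = (bumpPer K R ((ξ μ x - ((k μ).val : ℝ)) + s) - 2 * bumpPer K R (ξ μ x - ((k μ).val : ℝ))
          + bumpPer K R ((ξ μ x - ((k μ).val : ℝ)) - s)) * Pr by ring_nf, abs_mul, abs_of_nonneg hPr.1]
  exact (mul_le_of_le_one_right (abs_nonneg _) hPr.2).trans (abs_bumpPer_second_diff_le hK hR hRK hs hs1)

/-! ## §2 The block cut-off on King's fine torus -/

variable (N : ℕ) [NeZero N] (M : Fin (d + 1) → ℕ) [∀ μ, NeZero (M μ)]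

omit [NeZero N] [∀ μ, NeZero (M μ)] in
/-- `0 ≤ χ_b ≤ 1`. [folklore] -/
theorem blockBump_nonneg (Kc : ℕ) (b : Tor M) (x : Tor (fine N M)) : 0 ≤ bcube Kc (fun ν (x : Tor (fine N M)) => (((x ν).val : ℕ) : ℝ) / N - (1 + 1 / (N : ℝ)) / 2) 1 (fun ν => (((b ν).val : ℕ) : ZMod Kc)) x := bcube_nonneg _ _ _ _ _

omit [NeZero N] [∀ μ, NeZero (M μ)] in
/-- `χ_b ≤ 1`. [folklore] -/
theorem blockBump_le_one (Kc : ℕ) (b : Tor M) (x : Tor (fine N M)) : bcube Kc (fun ν (x : Tor (fine N M)) => (((x ν).val : ℕ) : ℝ) / N - (1 + 1 / (N : ℝ)) / 2) 1 (fun ν => (((b ν).val : ℕ) : ZMod Kc)) x ≤ 1 := bcube_le_one _ _ _ _ _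

variable {N M} in
/-- FILE 61's shift compatibility for the block coordinates: `ξ_ν(x + e_μ) = ξ_ν(x) + δ_{νμ}∕N + z·Kc` (dag-n15-w4 g0 `kingTorus_hξ`, the centring
constant cancels). [folklore] -/
theorem bumpXi_hξ {Kc : ℕ} (hM : ∀ μ, M μ = Kc) (μ ν : Fin (d + 1)) (x : Tor (fine N M)) :
    ∃ z : ℤ, ((((Equiv.addRight (unitVec (fine N M) μ) x) ν).val : ℕ) : ℝ) / N - (1 + 1 / (N : ℝ)) / 2 = (((x ν).val : ℕ) : ℝ) / N - (1 + 1 / (N : ℝ)) / 2 + (if ν = μ then 1 / (N : ℝ) else 0) + z * Kc := by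
  have hN0 : 0 < N := Nat.pos_of_ne_zero (NeZero.ne N)
  have hfine : ∀ μ', fine N M μ' = Kc * N := fun μ' => by show N * M μ' = Kc * N; rw [hM μ', mul_comm]
  obtain ⟨z, hz⟩ := kingTorus_hξ (N := fine N M) (K := Kc) (m := N) hfine hN0 μ ν x
  have e : N15.KingTorusLine.unitVec (fine N M) μ = unitVec (fine N M) μ := rfl
  rw [e] at hz
  refine ⟨z, ?_⟩
  rw [hz]
  ring

variable {N M} in
/-- Iterating: the coordinates of `x + e_μ + e_ν`. [folklore] -/
theorem bumpXi_hξ₂ {Kc : ℕ} (hM : ∀ μ, M μ = Kc) (μ ν ρ : Fin (d + 1)) (x : Tor (fine N M)) :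
    ∃ z : ℤ, ((((x + unitVec (fine N M) μ + unitVec (fine N M) ν) ρ).val : ℕ) : ℝ) / N - (1 + 1 / (N : ℝ)) / 2
      = (((x ρ).val : ℕ) : ℝ) / N - (1 + 1 / (N : ℝ)) / 2 + ((if ρ = μ then 1 / (N : ℝ) else 0) + (if ρ = ν then 1 / (N : ℝ) else 0)) + z * Kc := by
  obtain ⟨z₁, h₁⟩ := bumpXi_hξ hM μ ρ x
  obtain ⟨z₂, h₂⟩ := bumpXi_hξ hM ν ρ (x + unitVec (fine N M) μ)
  refine ⟨z₁ + z₂, ?_⟩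
  simp only [Equiv.coe_addRight] at h₁ h₂
  rw [h₂, h₁]
  push_cast
  ring

variable {N M} in
/-- The cut-off's coordinate relative to its centre, at a point of block `b″` with in-block offset `j`:
`ξ_ν(site b″ j) − b_ν = (b″_ν − b_ν) + (j_ν∕N − (1 + 1∕N)∕2)`. [folklore] -/
theorem bumpXi_site_sub {Kc : ℕ} (hM : ∀ μ, M μ = Kc) (b b'' : Tor M) (j : Fin (d + 1) → Fin N) (ν : Fin (d + 1)) :
    ((((site N M b'' j) ν).val : ℕ) : ℝ) / N - (1 + 1 / (N : ℝ)) / 2 - (((((b ν).val : ℕ) : ZMod Kc)).val : ℝ)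
      = (((b'' ν).val : ℝ) - ((b ν).val : ℝ)) + (((j ν : ℕ) : ℝ) / N - (1 + 1 / (N : ℝ)) / 2) := by
  have hN0 : (N : ℝ) ≠ 0 := by exact_mod_cast NeZero.ne N
  have hb : (b ν).val < Kc := by rw [← hM ν]; exact ZMod.val_lt _
  rw [ZMod.val_cast_of_lt hb]
  rw [val_site]
  push_cast
  field_simp
  ring

omit [NeZero N] in
/-- The in-block offset term is small: `|j∕N − (1 + 1∕N)∕2 + c| ≤ 1` for `0 ≤ c ≤ 2∕N` (`0 ≤ j ≤ N − 1`). [folklore] -/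
theorem abs_offset_add_le_one (hN : 1 ≤ N) (j : Fin N) {c : ℝ} (hc0 : 0 ≤ c) (hc : c ≤ 2 / (N : ℝ)) :
    |((j : ℕ) : ℝ) / N - (1 + 1 / (N : ℝ)) / 2 + c| ≤ 1 := by
  have hNr : (1 : ℝ) ≤ N := by exact_mod_cast hN
  have hNpos : (0 : ℝ) < N := by linarith
  have hj : ((j : ℕ) : ℝ) ≤ N - 1 := by
    have := j.isLt
    have h' : (j : ℕ) + 1 ≤ N := this
    have h'' : ((j : ℕ) : ℝ) + 1 ≤ N := by exact_mod_cast h'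
    linarith
  have hj0 : (0 : ℝ) ≤ ((j : ℕ) : ℝ) := by positivity
  rw [abs_le]
  constructor
  · have h1 : 0 ≤ ((j : ℕ) : ℝ) / N := by positivity
    have h2 : (1 + 1 / (N : ℝ)) / 2 ≤ 1 := by
      rw [div_le_one (by norm_num : (0:ℝ) < 2)]
      have : 1 / (N : ℝ) ≤ 1 := by rw [div_le_one hNpos]; exact hNr
      linarith
    linarith
  · have h1 : ((j : ℕ) : ℝ) / N ≤ (N - 1) / N := div_le_div_of_nonneg_right hj hNpos.le
    have h3 : (N - 1) / (N : ℝ) - (1 + 1 / (N : ℝ)) / 2 + 2 / (N : ℝ) = (N + 1) / (2 * N) := by field_simp; ring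
    have h4 : ((N : ℝ) + 1) / (2 * N) ≤ 1 := by rw [div_le_one (by positivity)]; linarith
    linarith

omit [NeZero N] in
/-- … and `|j∕N − (1 + 1∕N)∕2| ≤ (N + 1)∕(2N)`. [folklore] -/
theorem abs_offset_le (hN : 1 ≤ N) (j : Fin N) : |((j : ℕ) : ℝ) / N - (1 + 1 / (N : ℝ)) / 2| ≤ ((N : ℝ) + 1) / (2 * N) := by
  have hNr : (1 : ℝ) ≤ N := by exact_mod_cast hN
  have hNpos : (0 : ℝ) < N := by linarith
  have hj : ((j : ℕ) : ℝ) ≤ N - 1 := by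
    have h' : (j : ℕ) + 1 ≤ N := j.isLt
    have h'' : ((j : ℕ) : ℝ) + 1 ≤ N := by exact_mod_cast h'
    linarith
  have hj0 : (0 : ℝ) ≤ ((j : ℕ) : ℝ) := by positivity
  have e1 : (1 + 1 / (N : ℝ)) / 2 = ((N : ℝ) + 1) / (2 * N) := by field_simp
  rw [e1, abs_le]
  constructor
  · have : 0 ≤ ((j : ℕ) : ℝ) / N := by positivity
    linarith
  · have h1 : ((j : ℕ) : ℝ) / N ≤ (N - 1) / N := div_le_div_of_nonneg_right hj hNpos.le
    have h2 : ((N : ℝ) - 1) / N = 2 * (((N : ℝ) + 1) / (2 * N)) - 2 / N := by field_simp; ring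
    have h3 : 0 ≤ 2 / (N : ℝ) := by positivity
    linarith

variable {N M} in
/-- ★ **THE PLATEAU**: at every point `y` whose coordinates are those of a point `x` of block `b` moved by `0 ≤ c_ν ≤ 2∕N` (modulo the period) —
in particular at `x`, `x + e_μ`, `x + e_μ + e_ν` — the cut-off equals `1` (every `N ≥ 1`, `Kc ≥ 1`). [folklore] -/
theorem blockBump_eq_one_of_coords {Kc : ℕ} (hM : ∀ μ, M μ = Kc) (hKc : 0 < Kc) {b : Tor M} {x y : Tor (fine N M)} (hx : blockOf N M x = b)
    (c : Fin (d + 1) → ℝ) (hc0 : ∀ ν, 0 ≤ c ν) (hc : ∀ ν, c ν ≤ 2 / (N : ℝ))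
    (hy : ∀ ν, ∃ z : ℤ, (((y ν).val : ℕ) : ℝ) / N - (1 + 1 / (N : ℝ)) / 2 = (((x ν).val : ℕ) : ℝ) / N - (1 + 1 / (N : ℝ)) / 2 + c ν + z * Kc) : bcube Kc (fun ν (x : Tor (fine N M)) => (((x ν).val : ℕ) : ℝ) / N - (1 + 1 / (N : ℝ)) / 2) 1 (fun ν => (((b ν).val : ℕ) : ZMod Kc)) y = 1 := by
  have hN1 : 1 ≤ N := Nat.one_le_iff_ne_zero.mpr (NeZero.ne N)
  refine bcube_eq_one_of_forall_abs_cenRep_le Kc (fun ν (x : Tor (fine N M)) => (((x ν).val : ℕ) : ℝ) / N - (1 + 1 / (N : ℝ)) / 2) 1 fun ν => ?_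
  obtain ⟨z, hz⟩ := hy ν
  obtain ⟨⟨b'', j⟩, hbj⟩ := (blockEquiv N M).surjective x
  have hxs : x = site N M b'' j := by rw [← hbj, blockEquiv_apply]
  have hb'' : b'' = b := by rw [← hx, hxs, blockOf_site]
  subst hb''
  have hsite := bumpXi_site_sub hM b'' b'' j ν
  rw [hz, show (((x ν).val : ℕ) : ℝ) / N - (1 + 1 / (N : ℝ)) / 2 + c ν + z * Kc - (((((b'' ν).val : ℕ) : ZMod Kc)).val : ℝ)
      = ((((x ν).val : ℕ) : ℝ) / N - (1 + 1 / (N : ℝ)) / 2 - (((((b'' ν).val : ℕ) : ZMod Kc)).val : ℝ) + c ν) + z * Kc by ring, cenRep_add_int_mul hKc, hxs, hsite, sub_self, zero_add]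
  refine (abs_cenRep_le_abs_sub hKc _ 0).trans ?_
  rw [Int.cast_zero, zero_mul, sub_zero]
  exact abs_offset_add_le_one N hN1 (j ν) (hc0 ν) (hc ν)

variable {N M} in
/-- The plateau contains the block: `B(x) = b ⟹ χ_b(x) = 1`. [folklore] -/
theorem blockBump_eq_one_of_blockOf_eq {Kc : ℕ} (hM : ∀ μ, M μ = Kc) (hKc : 0 < Kc) {b : Tor M} {x : Tor (fine N M)} (hx : blockOf N M x = b) :
    bcube Kc (fun ν (x : Tor (fine N M)) => (((x ν).val : ℕ) : ℝ) / N - (1 + 1 / (N : ℝ)) / 2) 1 (fun ν => (((b ν).val : ℕ) : ZMod Kc)) x = 1 :=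
  blockBump_eq_one_of_coords hM hKc hx (fun _ => 0) (fun _ => le_rfl) (fun _ => by positivity) fun ν => ⟨0, by push_cast; ring⟩

variable {N M} in
/-- … its one-step forward shifts: `B(x) = b ⟹ χ_b(x + e_μ) = 1`. [folklore] -/
theorem blockBump_add_eq_one_of_blockOf_eq {Kc : ℕ} (hM : ∀ μ, M μ = Kc) (hKc : 0 < Kc) {b : Tor M} {x : Tor (fine N M)} (hx : blockOf N M x = b)
    (μ : Fin (d + 1)) : bcube Kc (fun ν (x : Tor (fine N M)) => (((x ν).val : ℕ) : ℝ) / N - (1 + 1 / (N : ℝ)) / 2) 1 (fun ν => (((b ν).val : ℕ) : ZMod Kc)) (x + unitVec (fine N M) μ) = 1 := by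
  have hN : (0 : ℝ) < N := by exact_mod_cast Nat.pos_of_ne_zero (NeZero.ne N)
  refine blockBump_eq_one_of_coords hM hKc hx (fun ν => if ν = μ then 1 / (N : ℝ) else 0) (fun ν => by split_ifs <;> positivity)
    (fun ν => ?_) fun ν => ?_
  · split_ifs
    · rw [div_le_div_iff_of_pos_right hN]; norm_num
    · positivity
  · simpa only [Equiv.coe_addRight] using bumpXi_hξ hM μ ν x

variable {N M} in
/-- … and its two-step forward shifts: `B(x) = b ⟹ χ_b(x + e_μ + e_ν) = 1`. [folklore] -/
theorem blockBump_add_add_eq_one_of_blockOf_eq {Kc : ℕ} (hM : ∀ μ, M μ = Kc) (hKc : 0 < Kc) {b : Tor M} {x : Tor (fine N M)}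
    (hx : blockOf N M x = b) (μ ν : Fin (d + 1)) : bcube Kc (fun ν (x : Tor (fine N M)) => (((x ν).val : ℕ) : ℝ) / N - (1 + 1 / (N : ℝ)) / 2) 1 (fun ν => (((b ν).val : ℕ) : ZMod Kc)) (x + unitVec (fine N M) μ + unitVec (fine N M) ν) = 1 := by
  have hN : (0 : ℝ) < N := by exact_mod_cast Nat.pos_of_ne_zero (NeZero.ne N)
  refine blockBump_eq_one_of_coords hM hKc hx (fun ρ => (if ρ = μ then 1 / (N : ℝ) else 0) + (if ρ = ν then 1 / (N : ℝ) else 0))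
    (fun ρ => by positivity) (fun ρ => ?_) (fun ρ => bumpXi_hξ₂ hM μ ν ρ x)
  have h2 : 2 / (N : ℝ) = 1 / N + 1 / N := by ring
  rw [h2]
  exact add_le_add (by split_ifs <;> [exact le_rfl; positivity]) (by split_ifs <;> [exact le_rfl; positivity])

variable {N M} in
/-- ★ **THE SUPPORT**: if the cut-off is nonzero at a point `y` whose coordinates are those of `x` moved by `|c_ν| ≤ 1∕N` (modulo the period) — in
particular `y ∈ {x, x ± e_μ}` — then the block of `x` is at sup-distance `≤ 2` from `b` (`N ≥ 3`). [folklore] -/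
theorem tdistT_le_two_of_blockBump_ne_zero {Kc : ℕ} (hM : ∀ μ, M μ = Kc) (hKc : 0 < Kc) (hN3 : 3 ≤ N) {b : Tor M} {x y : Tor (fine N M)}
    (c : Fin (d + 1) → ℝ) (hc : ∀ ν, |c ν| ≤ 1 / (N : ℝ)) (hy : ∀ ν, ∃ z : ℤ, (((y ν).val : ℕ) : ℝ) / N - (1 + 1 / (N : ℝ)) / 2 = (((x ν).val : ℕ) : ℝ) / N - (1 + 1 / (N : ℝ)) / 2 + c ν + z * Kc)
    (hne : bcube Kc (fun ν (x : Tor (fine N M)) => (((x ν).val : ℕ) : ℝ) / N - (1 + 1 / (N : ℝ)) / 2) 1 (fun ν => (((b ν).val : ℕ) : ZMod Kc)) y ≠ 0) : tdistT M b (blockOf N M x) ≤ 2 := by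
  have hN1 : 1 ≤ N := by omega
  have hNr : (3 : ℝ) ≤ N := by exact_mod_cast hN3
  have hNpos : (0 : ℝ) < N := by linarith
  obtain ⟨⟨b'', j⟩, hbj⟩ := (blockEquiv N M).surjective x
  have hxs : x = site N M b'' j := by rw [← hbj, blockEquiv_apply]
  have hbx : blockOf N M x = b'' := by rw [hxs, blockOf_site]
  rw [hbx]
  refine tdistT_le_of_coord M b b'' 2 fun ν => ?_
  have hlt := abs_cenRep_lt_of_bcube_ne_zero Kc (fun ν (x : Tor (fine N M)) => (((x ν).val : ℕ) : ℝ) / N - (1 + 1 / (N : ℝ)) / 2) 1 hne ν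
  obtain ⟨z, hz⟩ := hy ν
  have hsite := bumpXi_site_sub hM b b'' j ν
  set w : ℤ := ((b'' ν).val : ℤ) - ((b ν).val : ℤ) with hw
  set t : ℝ := ((j ν : ℕ) : ℝ) / N - (1 + 1 / (N : ℝ)) / 2 with ht
  have harg : (((y ν).val : ℕ) : ℝ) / N - (1 + 1 / (N : ℝ)) / 2 - (((((b ν).val : ℕ) : ZMod Kc)).val : ℝ) = ((w : ℝ) + t + c ν) + z * Kc := by
    rw [hz, show (((x ν).val : ℕ) : ℝ) / N - (1 + 1 / (N : ℝ)) / 2 + c ν + z * Kc - (((((b ν).val : ℕ) : ZMod Kc)).val : ℝ)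
      = ((((x ν).val : ℕ) : ℝ) / N - (1 + 1 / (N : ℝ)) / 2 - (((((b ν).val : ℕ) : ZMod Kc)).val : ℝ)) + c ν + z * Kc by ring, hxs, hsite, hw]
    push_cast
    ring
  rw [harg, cenRep_add_int_mul hKc] at hlt
  -- `cenRep` is a shift by an integer multiple of the period
  set r : ℤ := round (((w : ℝ) + t + c ν) / Kc) with hr
  have hcr : cenRep Kc ((w : ℝ) + t + c ν) = ((w : ℝ) + t + c ν) - Kc * r := rfl
  rw [hcr] at hlt
  have htb : |t| ≤ ((N : ℝ) + 1) / (2 * N) := abs_offset_le N hN1 (j ν)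
  have hcb := hc ν
  have hslack : ((N : ℝ) + 1) / (2 * N) + 1 / N ≤ 1 := by
    rw [show ((N : ℝ) + 1) / (2 * N) + 1 / N = (N + 3) / (2 * N) by field_simp; ring, div_le_one (by positivity)]
    linarith
  have hwr : |((w - Kc * r : ℤ) : ℝ)| < 3 := by
    push_cast
    have e : ((w : ℝ) - Kc * r) = ((w : ℝ) + t + c ν - Kc * r) - t - c ν := by ring
    rw [e]
    calc |((w : ℝ) + t + c ν - Kc * r) - t - c ν| ≤ |(w : ℝ) + t + c ν - Kc * r| + |t| + |c ν| := by
          have := abs_sub ((w : ℝ) + t + c ν - Kc * r - t) (c ν)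
          have := abs_sub ((w : ℝ) + t + c ν - Kc * r) t
          linarith
      _ < 2 + ((N : ℝ) + 1) / (2 * N) + 1 / N := by linarith
      _ ≤ 3 := by linarith
  have hwr' : |w - Kc * r| ≤ 2 := by
    have h3 : |w - Kc * r| < 3 := by exact_mod_cast hwr
    have h4 := abs_lt.mp h3
    exact abs_le.mpr ⟨by omega, by omega⟩
  -- the circular coordinate distance of the two blocks
  have hKM : ((M ν : ℕ) : ℤ) = (Kc : ℤ) := by rw [hM ν]
  have hper : circAbs (M ν) (((b ν).val : ℤ) - ((b'' ν).val : ℤ)) = circAbs (M ν) (-(w - Kc * r)) := by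
    rw [show -(w - Kc * r) = (((b ν).val : ℤ) - ((b'' ν).val : ℤ)) + ((M ν : ℕ) : ℤ) * r by rw [hw, hKM]; ring,
      circAbs_add_mul]
  rw [hper]
  refine (circAbs_le_abs (Nat.one_le_iff_ne_zero.mpr (NeZero.ne (M ν))) _).trans ?_
  rw [abs_neg]
  exact_mod_cast hwr'

variable {N M} in
/-- The support, read at the point itself: `χ_b(x) ≠ 0 ⟹ |b − B(x)| ≤ 2`. [folklore] -/
theorem tdistT_le_two_of_blockBump_ne_zero_self {Kc : ℕ} (hM : ∀ μ, M μ = Kc) (hKc : 0 < Kc) (hN3 : 3 ≤ N) {b : Tor M}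
    {x : Tor (fine N M)} (hne : bcube Kc (fun ν (x : Tor (fine N M)) => (((x ν).val : ℕ) : ℝ) / N - (1 + 1 / (N : ℝ)) / 2) 1 (fun ν => (((b ν).val : ℕ) : ZMod Kc)) x ≠ 0) : tdistT M b (blockOf N M x) ≤ 2 :=
  tdistT_le_two_of_blockBump_ne_zero hM hKc hN3 (fun _ => 0) (fun _ => by rw [abs_zero]; positivity) (fun ν => ⟨0, by push_cast; ring⟩) hne

variable {N M} in
/-- … one step forward: `χ_b(x + e_μ) ≠ 0 ⟹ |b − B(x)| ≤ 2`. [folklore] -/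
theorem tdistT_le_two_of_blockBump_add_ne_zero {Kc : ℕ} (hM : ∀ μ, M μ = Kc) (hKc : 0 < Kc) (hN3 : 3 ≤ N) {b : Tor M}
    {x : Tor (fine N M)} (μ : Fin (d + 1)) (hne : bcube Kc (fun ν (x : Tor (fine N M)) => (((x ν).val : ℕ) : ℝ) / N - (1 + 1 / (N : ℝ)) / 2) 1 (fun ν => (((b ν).val : ℕ) : ZMod Kc)) (x + unitVec (fine N M) μ) ≠ 0) : tdistT M b (blockOf N M x) ≤ 2 := by
  have hN : (0 : ℝ) < N := by exact_mod_cast Nat.pos_of_ne_zero (NeZero.ne N)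
  refine tdistT_le_two_of_blockBump_ne_zero hM hKc hN3 (fun ν => if ν = μ then 1 / (N : ℝ) else 0) (fun ν => ?_) (fun ν => ?_) hne
  · split_ifs
    · rw [abs_of_pos (by positivity)]
    · rw [abs_zero]; positivity
  · simpa only [Equiv.coe_addRight] using bumpXi_hξ hM μ ν x

variable {N M} in
/-- … one step backward: `χ_b(x − e_μ) ≠ 0 ⟹ |b − B(x)| ≤ 2`. [folklore] -/
theorem tdistT_le_two_of_blockBump_sub_ne_zero {Kc : ℕ} (hM : ∀ μ, M μ = Kc) (hKc : 0 < Kc) (hN3 : 3 ≤ N) {b : Tor M}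
    {x : Tor (fine N M)} (μ : Fin (d + 1)) (hne : bcube Kc (fun ν (x : Tor (fine N M)) => (((x ν).val : ℕ) : ℝ) / N - (1 + 1 / (N : ℝ)) / 2) 1 (fun ν => (((b ν).val : ℕ) : ZMod Kc)) (x - unitVec (fine N M) μ) ≠ 0) : tdistT M b (blockOf N M x) ≤ 2 := by
  have hN : (0 : ℝ) < N := by exact_mod_cast Nat.pos_of_ne_zero (NeZero.ne N)
  refine tdistT_le_two_of_blockBump_ne_zero hM hKc hN3 (fun ν => if ν = μ then -(1 / (N : ℝ)) else 0) (fun ν => ?_) (fun ν => ?_) hne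
  · split_ifs
    · rw [abs_neg, abs_of_pos (by positivity)]
    · rw [abs_zero]; positivity
  · obtain ⟨z, hz⟩ := bumpXi_hξ hM μ ν (x - unitVec (fine N M) μ)
    simp only [Equiv.coe_addRight, sub_add_cancel] at hz
    refine ⟨-z, ?_⟩
    rw [hz]
    push_cast
    split_ifs <;> ring

variable {N M} in
/-- **THE GRADIENT LETTER**: `|χ_b(x + e_μ) − χ_b(x)| ≤ π∕N` (FILE II `abs_fgrad_bcube_le`). [cite: Balaban1984PropagatorsII, (2.36) p.229 («|∂h| ≤ O(1)M⁻¹»: shape)] -/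
theorem abs_blockBump_add_sub_le {Kc : ℕ} (hM : ∀ μ, M μ = Kc) (hKc : 0 < Kc) (b : Tor M) (x : Tor (fine N M)) (μ : Fin (d + 1)) :
    |bcube Kc (fun ν (x : Tor (fine N M)) => (((x ν).val : ℕ) : ℝ) / N - (1 + 1 / (N : ℝ)) / 2) 1 (fun ν => (((b ν).val : ℕ) : ZMod Kc)) (x + unitVec (fine N M) μ) - bcube Kc (fun ν (x : Tor (fine N M)) => (((x ν).val : ℕ) : ℝ) / N - (1 + 1 / (N : ℝ)) / 2) 1 (fun ν => (((b ν).val : ℕ) : ZMod Kc)) x| ≤ π / N := by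
  have hN : (0 : ℝ) < N := by exact_mod_cast Nat.pos_of_ne_zero (NeZero.ne N)
  have h := abs_fgrad_bcube_le Kc (fun ν (x : Tor (fine N M)) => (((x ν).val : ℕ) : ℝ) / N - (1 + 1 / (N : ℝ)) / 2) 1 (fun μ => Equiv.addRight (unitVec (fine N M) μ)) hKc (bumpXi_hξ hM) 1
    (fun ν => (((b ν).val : ℕ) : ZMod Kc)) μ x
  simp only [N15.BackgroundLayer.fgrad_apply, Equiv.coe_addRight, one_mul, abs_one] at h
  rw [abs_of_pos (div_pos one_pos hN)] at h
  simpa only [mul_one_div] using h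

variable {N M} in
/-- `|χ_b(x − e_μ) − χ_b(x)| ≤ π∕N` (FILE II `abs_bgrad_bcube_le`). [cite: Balaban1984PropagatorsII, (2.36) p.229 (shape)] -/
theorem abs_blockBump_sub_sub_le {Kc : ℕ} (hM : ∀ μ, M μ = Kc) (hKc : 0 < Kc) (b : Tor M) (x : Tor (fine N M)) (μ : Fin (d + 1)) :
    |bcube Kc (fun ν (x : Tor (fine N M)) => (((x ν).val : ℕ) : ℝ) / N - (1 + 1 / (N : ℝ)) / 2) 1 (fun ν => (((b ν).val : ℕ) : ZMod Kc)) (x - unitVec (fine N M) μ) - bcube Kc (fun ν (x : Tor (fine N M)) => (((x ν).val : ℕ) : ℝ) / N - (1 + 1 / (N : ℝ)) / 2) 1 (fun ν => (((b ν).val : ℕ) : ZMod Kc)) x| ≤ π / N := by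
  have hN : (0 : ℝ) < N := by exact_mod_cast Nat.pos_of_ne_zero (NeZero.ne N)
  have h := abs_bgrad_bcube_le Kc (fun ν (x : Tor (fine N M)) => (((x ν).val : ℕ) : ℝ) / N - (1 + 1 / (N : ℝ)) / 2) 1 (fun μ => Equiv.addRight (unitVec (fine N M) μ)) hKc (bumpXi_hξ hM) 1
    (fun ν => (((b ν).val : ℕ) : ZMod Kc)) μ x
  simp only [N15.BackgroundLayer.bgrad_apply, Equiv.addRight_symm, Equiv.coe_addRight, one_mul, abs_one, ← sub_eq_add_neg] at h
  rw [abs_of_pos (div_pos one_pos hN), abs_sub_comm] at h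
  simpa only [mul_one_div] using h

variable {N M} in
/-- **THE SECOND-DIFFERENCE LETTER**: `|χ_b(x + e_μ) − 2χ_b(x) + χ_b(x − e_μ)| ≤ 16π⁴∕N²` for volumes `Kc ≥ 6` (= `2R + 4`, `R = 1`).
[cite: Balaban1984PropagatorsII, (2.36) p.229 («|∂²h| ≤ O(1)M⁻²»: shape)] -/
theorem abs_sdiff_blockBump_le {Kc : ℕ} (hM : ∀ μ, M μ = Kc) (hKc6 : 6 ≤ Kc) (b : Tor M) (x : Tor (fine N M)) (μ : Fin (d + 1)) :
    |bcube Kc (fun ν (x : Tor (fine N M)) => (((x ν).val : ℕ) : ℝ) / N - (1 + 1 / (N : ℝ)) / 2) 1 (fun ν => (((b ν).val : ℕ) : ZMod Kc)) (x + unitVec (fine N M) μ) - 2 * bcube Kc (fun ν (x : Tor (fine N M)) => (((x ν).val : ℕ) : ℝ) / N - (1 + 1 / (N : ℝ)) / 2) 1 (fun ν => (((b ν).val : ℕ) : ZMod Kc)) x + bcube Kc (fun ν (x : Tor (fine N M)) => (((x ν).val : ℕ) : ℝ) / N - (1 + 1 / (N : ℝ)) / 2) 1 (fun ν => (((b ν).val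 : ℕ) : ZMod Kc)) (x - unitVec (fine N M) μ)|
      ≤ 16 * π ^ 4 / (N : ℝ) ^ 2 := by
  have hN1 : 1 ≤ N := Nat.one_le_iff_ne_zero.mpr (NeZero.ne N)
  have hN : (0 : ℝ) < N := by exact_mod_cast hN1
  have hKc : 0 < Kc := by omega
  have hRK : 2 * (1 : ℝ) + 4 ≤ Kc := by
    have : (6 : ℝ) ≤ Kc := by exact_mod_cast hKc6
    linarith
  have hs1 : 1 / (N : ℝ) ≤ 1 := by rw [div_le_one hN]; exact_mod_cast hN1
  have h := abs_sdiff_bcube_le Kc (fun ν (x : Tor (fine N M)) => (((x ν).val : ℕ) : ℝ) / N - (1 + 1 / (N : ℝ)) / 2) (fun μ => Equiv.addRight (unitVec (fine N M) μ)) hKc (bumpXi_hξ hM) zero_le_one hRK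
    (by positivity) hs1 (fun ν => (((b ν).val : ℕ) : ZMod Kc)) μ x
  simp only [Equiv.addRight_symm, Equiv.coe_addRight, ← sub_eq_add_neg] at h
  refine h.trans (le_of_eq ?_)
  field_simp

variable {N M} in
/-- ★ **THE LAPLACIAN OF THE CUT-OFF**: `|(Δχ_b)(x)| ≤ 16π⁴(d+1)∕N²` (volumes `Kc ≥ 6`). [cite: Balaban1984PropagatorsII, (2.36) p.229 (shape)] -/
theorem abs_lapOp_blockBump_le {Kc : ℕ} (hM : ∀ μ, M μ = Kc) (hKc6 : 6 ≤ Kc) (b : Tor M) (x : Tor (fine N M)) :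
    |lapOp (fine N M) (bcube Kc (fun ν (x : Tor (fine N M)) => (((x ν).val : ℕ) : ℝ) / N - (1 + 1 / (N : ℝ)) / 2) 1 (fun ν => (((b ν).val : ℕ) : ZMod Kc))) x| ≤ 16 * π ^ 4 * (d + 1) / (N : ℝ) ^ 2 := by
  rw [lapOp_apply]
  refine (Finset.abs_sum_le_sum_abs _ _).trans ?_
  have hterm : ∀ μ ∈ (Finset.univ : Finset (Fin (d + 1))),
      |bcube Kc (fun ν (x : Tor (fine N M)) => (((x ν).val : ℕ) : ℝ) / N - (1 + 1 / (N : ℝ)) / 2) 1 (fun ν => (((b ν).val : ℕ) : ZMod Kc)) (x + unitVec (fine N M) μ) + bcube Kc (fun ν (x : Tor (fine N M)) => (((x ν).val : ℕ) : ℝ) / N - (1 + 1 / (N : ℝ)) / 2) 1 (fun ν => (((b ν).val : ℕ) : ZMod Kc)) (x - unitVec (fine N M) μ) - 2 * bcube Kc (fun ν (x : Tor (fine N M)) => (((x ν).val : ℕ) : ℝ) / N - (1 + 1 / (N : ℝ)) / 2) 1 (fun ν => (((b ν).val : ℕ) : ZMod Kc)) x|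
        ≤ 16 * π ^ 4 / (N : ℝ) ^ 2 := fun μ _ => by
    rw [show bcube Kc (fun ν (x : Tor (fine N M)) => (((x ν).val : ℕ) : ℝ) / N - (1 + 1 / (N : ℝ)) / 2) 1 (fun ν => (((b ν).val : ℕ) : ZMod Kc)) (x + unitVec (fine N M) μ) + bcube Kc (fun ν (x : Tor (fine N M)) => (((x ν).val : ℕ) : ℝ) / N - (1 + 1 / (N : ℝ)) / 2) 1 (fun ν => (((b ν).val : ℕ) : ZMod Kc)) (x - unitVec (fine N M) μ) - 2 * bcube Kc (fun ν (x : Tor (fine N M)) => (((x ν).val : ℕ) : ℝ) / N - (1 + 1 / (N : ℝ)) / 2) 1 (fun ν => (((b ν).val : ℕ) : ZMod Kc)) x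
      = bcube Kc (fun ν (x : Tor (fine N M)) => (((x ν).val : ℕ) : ℝ) / N - (1 + 1 / (N : ℝ)) / 2) 1 (fun ν => (((b ν).val : ℕ) : ZMod Kc)) (x + unitVec (fine N M) μ) - 2 * bcube Kc (fun ν (x : Tor (fine N M)) => (((x ν).val : ℕ) : ℝ) / N - (1 + 1 / (N : ℝ)) / 2) 1 (fun ν => (((b ν).val : ℕ) : ZMod Kc)) x + bcube Kc (fun ν (x : Tor (fine N M)) => (((x ν).val : ℕ) : ℝ) / N - (1 + 1 / (N : ℝ)) / 2) 1 (fun ν => (((b ν).val : ℕ) : ZMod Kc)) (x - unitVec (fine N M) μ) by ring]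
    exact abs_sdiff_blockBump_le hM hKc6 b x μ
  refine (Finset.sum_le_sum hterm).trans (le_of_eq ?_)
  rw [Finset.sum_const, Finset.card_univ, Fintype.card_fin, nsmul_eq_mul]
  push_cast
  ring

end Bump

end Summit.QuantumFields.YangMills.BalabanUVNodes.N15KingModelRung.Curved

end
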